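import Literature.NumberTheory.Automorphic.UnitaryGroupArchimedeanPlaces
import Literature.NumberTheory.Automorphic.UnitaryGroupFormTransport
import Literature.Geometry.ComplexHyperbolic.UnitBallU21
import HarnessLib

/-!
# The archimedean projection `U(J)(E ⊗ ℝ) →* U(σ_{w₁} J)(ℂ) ≅ U(2,1)` at a distinguished place: open,
# surjective, compact kernel

Registry: pub-hodgecm MODEL-CONSTRUCTION sub-cell, EMB-INSTANCE chain link (4) ("arch junction"), automorphic
lane (node D1-aut-ix). Companion of `UnitaryGroupArchimedeanPlaces` (U2-vi: `archAt w : U(J)(E ⊗ ℝ) →* U(σ_w J)(ℂ)`,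
`archPiEquiv : U(J)(E ⊗ ℝ) ≃ₜ* Π_w U(σ_w J)(ℂ)`, `isCompact_archLocal_of_posDef`) and `UnitaryGroupFormTransport`
(U2-vii: `unitaryGroupOfFormCongrOfEq`).

Setting: `E/F` number fields, `c ∈ Aut(E/F)` with `c ≠ 1` fixing every infinite place (the CM situation), `J ∈ M_N(E)`,
and a distinguished complex place `w₁` of `E`.

* § 1 `archAt w₁` is an OPEN map (`isOpenMap_archAt`: a coordinate projection through `archPiEquiv`); its kernel is
  `{g | g_w = 1 at w₁}` = `archPiEquiv⁻¹ (∏_w (w = w₁ ? {1} : everything))` (`ker_archAt_eq_preimage_pi`) and is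
  COMPACT as soon as `σ_w(J)` is definite at every `w ≠ w₁` (`isCompact_ker_archAt`: Tychonoff +
  `isCompact_archLocal_of_posDef`) — "`G_∞ = U(2,1) × compact`" for a hermitian space of signature `(2,1)` at `w₁` and
  `(3,0)` elsewhere.
* § 2 `N = 3`: the tree's `U(2,1)` of the ball model, `BallModel.U21 = {g | gᴴ J₀ g = J₀}`, `J₀ = diag(1,1,-1)`, IS the
  unitary group `unitaryGroupOfForm ⋆ J₀` of the automorphic lane (`U21_eq_unitaryGroupOfForm`, definitional); for a
  frame `T ∈ GL₃(ℂ)` with `Tᴴ σ_{w₁}(J) T = J₀` (a Sylvester datum at `w₁` — a HYPOTHESIS here; its existence is the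
  signature-`(2,1)` input of the geometric side) the isomorphism `archLocalEquivU21 : U(σ_{w₁} J)(ℂ) ≃ₜ* U21`,
  `g ↦ T⁻¹ g T`, and the ARCHIMEDEAN PROJECTION **`archProjU21 : U(J)(E ⊗ ℝ) →* U21`**, `g ↦ T⁻¹ g_{w₁} T`:
  continuous, surjective, open, kernel `= ker (archAt w₁)` hence compact under definiteness at `w ≠ w₁`; on
  rational points `archProjU21 (γ ⊗ 1) = T⁻¹ σ_{w₁}(γ) T` (`coe_archProjU21_rationalToArch`).
* § 3 the CM specialisation (`F = L⁺`, `E = L`, `c` = complex conjugation): `archProjU21CM L H w₁ T hT` with the four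
  properties, hypotheses `c ≠ 1` / `c • w = w` discharged by `IsCMField.complexConj_ne_one` /
  `complexConj_smul_infinitePlace`.

Everything is proved (kernel); no named facts. NOT here: the arithmetic dictionary (image of an arithmetic
lattice under `archProjU21`), and the identification with the geometric lane's `UnitaryBallQuotientDatum.frameIso`
(whose `realPoints = unitaryGroup ⋆ Hℂ` has the same carrier as `archLocal` once `Hℂ = σ_{w₁}(J)`; one `Subgroup.ext`).
References for the objects: Platonov–Rapinchuk 1994 §2.3, §3.2 Thm 3.1; Borel–Jacquet 1979 §4.1.
-/

set_option autoImplicit false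

noncomputable section

open NumberField NumberField.InfinitePlace Topology

open scoped Matrix MatrixGroups ComplexConjugate ComplexOrder

namespace Literature.NumberTheory.Automorphic

/-! ## § 0. Equal subgroups of a topological group -/

section SubgroupCongr

variable {G : Type*} [Group G] [TopologicalSpace G]

/-- Equal subgroups of a topological group are isomorphic topological groups (Mathlib `MulEquiv.subgroupCongr`
with the evident continuity). [folklore] -/
def subgroupCongrTop {H K : Subgroup G} (h : H = K) : H ≃ₜ* K :=
  { MulEquiv.subgroupCongr h with
    continuous_toFun := continuous_subtype_val.subtype_mk _
    continuous_invFun := continuous_subtype_val.subtype_mk _ }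

/-- `subgroupCongrTop` is the identity on underlying elements. [folklore] -/
@[simp] theorem coe_subgroupCongrTop_apply {H K : Subgroup G} (h : H = K) (x : H) :
    ((subgroupCongrTop h x : K) : G) = x := rfl

/-- `subgroupCongrTop.symm` is the identity on underlying elements. [folklore] -/
@[simp] theorem coe_subgroupCongrTop_symm_apply {H K : Subgroup G} (h : H = K) (x : K) :
    (((subgroupCongrTop h).symm x : H) : G) = x := rfl

end SubgroupCongr

namespace UnitaryGroup

open NumberField.mixedEmbedding

variable (F E : Type) [Field F] [NumberField F] [Field E] [NumberField E] [Algebra F E]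
  (c : E ≃ₐ[F] E) (N : ℕ) (J : Matrix (Fin N) (Fin N) E)

/-! ## § 1. `archAt w₁`: open, kernel, compact kernel -/

section OnePlace

variable (hc : c ≠ 1) (hfix : ∀ w : InfinitePlace E, c • w = w) (w₁ : {w : InfinitePlace E // IsComplex w})

omit [NumberField F] [NumberField E] in
/-- `archAt w₁ = eval_{w₁} ∘ archPiEquiv`. [folklore] -/
theorem archAt_eq_eval_comp_archPiEquiv :
    (archAt F E c N J w₁ (hfix w₁.1) hc : arch F E c N J → archLocal E N J w₁) =
      Function.eval w₁ ∘ archPiEquiv F E c N J hc hfix :=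
  rfl

omit [NumberField F] [NumberField E] in
include hfix hc in
/-- **`archAt w₁ : U(J)(E ⊗ ℝ) →* U(σ_{w₁} J)(ℂ)` is an open map** (a coordinate projection of the product
`Π_w U(σ_w J)(ℂ)` through `archPiEquiv`). [folklore] -/
theorem isOpenMap_archAt : IsOpenMap (archAt F E c N J w₁ (hfix w₁.1) hc) := by
  rw [archAt_eq_eval_comp_archPiEquiv F E c N J hc hfix w₁]
  exact (isOpenMap_eval w₁).comp (archPiEquiv F E c N J hc hfix).toHomeomorph.isOpenMap

omit [NumberField F] [NumberField E] in
/-- Membership in the kernel of `archAt w₁`: the `w₁`-component is trivial. [folklore] -/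
theorem mem_ker_archAt_iff (g : arch F E c N J) :
    g ∈ (archAt F E c N J w₁ (hfix w₁.1) hc).ker ↔ archAt F E c N J w₁ (hfix w₁.1) hc g = 1 :=
  MonoidHom.mem_ker

omit [NumberField F] [NumberField E] in
/-- The kernel of `archAt w₁` is the preimage under `archPiEquiv` of the box `∏_w S_w`, `S_{w₁} = {1}`,
`S_w = everything` for `w ≠ w₁`. [folklore] -/
theorem ker_archAt_eq_preimage_pi [DecidableEq {w : InfinitePlace E // IsComplex w}] :
    ((archAt F E c N J w₁ (hfix w₁.1) hc).ker : Set (arch F E c N J)) =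
      archPiEquiv F E c N J hc hfix ⁻¹'
        Set.pi Set.univ (fun w => if w = w₁ then ({1} : Set (archLocal E N J w)) else Set.univ) := by
  ext g
  simp only [SetLike.mem_coe, MonoidHom.mem_ker, Set.mem_preimage, Set.mem_pi, Set.mem_univ, true_implies,
    archPiEquiv_apply]
  constructor
  · intro h w
    by_cases hw : w = w₁
    · subst hw; simpa using h
    · simp [hw]
  · intro h
    simpa using h w₁

omit [NumberField F] [NumberField E] in
include hfix hc in
/-- **The kernel of `archAt w₁` is compact when `σ_w(J)` is definite at every `w ≠ w₁`** — it is
`archPiEquiv⁻¹ ({1} × ∏_{w ≠ w₁} U(σ_w J)(ℂ))` with every factor `U(σ_w J)(ℂ)`, `w ≠ w₁`, compact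
(`isCompact_archLocal_of_posDef`; Tychonoff). For a hermitian space of signature `(2,1)` at `w₁` and `(3,0)` at the
other places: `U(J)(E ⊗ ℝ) = U(2,1) × compact`. (Platonov–Rapinchuk 1994 §3.2 Thm 3.1.)
[cite: PlatonovRapinchuk1994, §3.2 Thm 3.1] -/
theorem isCompact_ker_archAt
    (hdef : ∀ w : {w : InfinitePlace E // IsComplex w}, w ≠ w₁ →
      (J.map w.1.embedding).PosDef ∨ (-J.map w.1.embedding).PosDef) :
    IsCompact ((archAt F E c N J w₁ (hfix w₁.1) hc).ker : Set (arch F E c N J)) := by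
  classical
  rw [ker_archAt_eq_preimage_pi F E c N J hc hfix w₁]
  refine (archPiEquiv F E c N J hc hfix).toHomeomorph.isCompact_preimage.mpr (isCompact_univ_pi fun w => ?_)
  by_cases hw : w = w₁
  · subst hw
    simp only [if_true]
    exact isCompact_singleton
  · simp only [hw, if_false]
    haveI : CompactSpace (archLocal E N J w) := isCompact_iff_compactSpace.mp (isCompact_archLocal_of_posDef E N J w (hdef w hw))
    exact isCompact_univ

end OnePlace

/-! ## § 2. `N = 3`: the projection to `U(2,1)` of the ball model -/

section U21

open Literature.Geometry.ComplexHyperbolic Literature.Geometry.ComplexHyperbolic.BallModel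

/-- **`U(2,1)` of the ball model IS the unitary group `U(⋆, diag(1,1,-1))` of the automorphic lane** (both are
`{g ∈ GL₃(ℂ) | gᴴ J₀ g = J₀}`; definitional). [folklore] -/
theorem U21_eq_unitaryGroupOfForm : U21 = unitaryGroupOfForm (starRingEnd ℂ) BallModel.J := by
  ext g
  rw [mem_unitaryGroupOfForm_star_iff_conjTranspose]
  rfl

variable (J₃ : Matrix (Fin 3) (Fin 3) E) (w₁ : {w : InfinitePlace E // IsComplex w})
  (T : GL (Fin 3) ℂ) (hT : formCongr (starRingEnd ℂ) T (J₃.map w₁.1.embedding) = BallModel.J)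

omit [NumberField E] in
/-- **`U(σ_{w₁} J)(ℂ) ≃ₜ* U(2,1)`, `g ↦ T⁻¹ g T`**, for a frame `T` with `Tᴴ σ_{w₁}(J) T = diag(1,1,-1)`
(`unitaryGroupOfFormCongrOfEq` read backwards, then `U21_eq_unitaryGroupOfForm`). [cite: PlatonovRapinchuk1994, §2.3] -/
def archLocalEquivU21 : archLocal E 3 J₃ w₁ ≃ₜ* U21 :=
  (unitaryGroupOfFormCongrOfEq (starRingEnd ℂ) T (J₃.map w₁.1.embedding) BallModel.J hT).symm.trans
    (subgroupCongrTop U21_eq_unitaryGroupOfForm.symm)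

omit [NumberField E] in
/-- `archLocalEquivU21 g = T⁻¹ g T` on underlying invertible matrices. [folklore] -/
@[simp] theorem coe_archLocalEquivU21_apply (g : archLocal E 3 J₃ w₁) :
    ((archLocalEquivU21 E J₃ w₁ T hT g : U21) : GL (Fin 3) ℂ) = T⁻¹ * g * T := rfl

omit [NumberField E] in
/-- `archLocalEquivU21.symm u = T u T⁻¹` on underlying invertible matrices. [folklore] -/
@[simp] theorem coe_archLocalEquivU21_symm_apply (u : U21) :
    (((archLocalEquivU21 E J₃ w₁ T hT).symm u : archLocal E 3 J₃ w₁) : GL (Fin 3) ℂ) = T * u * T⁻¹ := rfl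

variable (hc : c ≠ 1) (hw₁ : c • w₁.1 = w₁.1)

/-- **The archimedean projection `U(J)(E ⊗ ℝ) →* U(2,1)`, `g ↦ T⁻¹ g_{w₁} T`** at the distinguished complex place
`w₁` (fixed by `c ≠ 1`), for a frame `T` with `Tᴴ σ_{w₁}(J) T = diag(1,1,-1)`. [cite: BorelJacquet1979, §4.1] -/
def archProjU21 : arch F E c 3 J₃ →* U21 :=
  (archLocalEquivU21 E J₃ w₁ T hT).toMonoidHom.comp (archAt F E c 3 J₃ w₁ hw₁ hc)

omit [NumberField F] [NumberField E] in
/-- `archProjU21 g = archLocalEquivU21 (archAt w₁ g)`. [folklore] -/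
theorem archProjU21_apply (g : arch F E c 3 J₃) :
    archProjU21 F E c J₃ w₁ T hT hc hw₁ g = archLocalEquivU21 E J₃ w₁ T hT (archAt F E c 3 J₃ w₁ hw₁ hc g) :=
  rfl

omit [NumberField F] [NumberField E] in
/-- `archProjU21 g = T⁻¹ g_{w₁} T` on underlying invertible matrices. [folklore] -/
@[simp] theorem coe_archProjU21_apply (g : arch F E c 3 J₃) :
    ((archProjU21 F E c J₃ w₁ T hT hc hw₁ g : U21) : GL (Fin 3) ℂ) =
      T⁻¹ * (archAt F E c 3 J₃ w₁ hw₁ hc g : archLocal E 3 J₃ w₁) * T :=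
  rfl

omit [NumberField F] [NumberField E] in
/-- **On rational points: `archProjU21 (γ ⊗ 1) = T⁻¹ σ_{w₁}(γ) T`** — the image of `U(J)(F)` (diagonally embedded by
`rationalToArch`) is the `T`-conjugate of its `σ_{w₁}`-image (`archAt_rationalToArch`); the handle for comparing
arithmetic lattices on the two sides of the junction. [folklore] -/
theorem coe_archProjU21_rationalToArch (γ : rational F E c 3 J₃) :
    ((archProjU21 F E c J₃ w₁ T hT hc hw₁ (rationalToArch F E c 3 J₃ γ) : U21) : GL (Fin 3) ℂ) =
      T⁻¹ * Matrix.GeneralLinearGroup.map w₁.1.embedding (γ : GL (Fin 3) E) * T := by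
  rw [coe_archProjU21_apply, archAt_rationalToArch, coe_rationalToArchLocal]

omit [NumberField F] [NumberField E] in
/-- `archProjU21` is continuous. [folklore] -/
theorem continuous_archProjU21 : Continuous (archProjU21 F E c J₃ w₁ T hT hc hw₁) :=
  (archLocalEquivU21 E J₃ w₁ T hT).continuous.comp (continuous_archAt F E c 3 J₃ w₁ hw₁ hc)

omit [NumberField F] [NumberField E] in
/-- The kernel of `archProjU21` is the kernel of `archAt w₁`. [folklore] -/
theorem ker_archProjU21 :
    (archProjU21 F E c J₃ w₁ T hT hc hw₁).ker = (archAt F E c 3 J₃ w₁ hw₁ hc).ker := by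
  ext g
  rw [MonoidHom.mem_ker, MonoidHom.mem_ker, archProjU21_apply]
  exact map_eq_one_iff _ (archLocalEquivU21 E J₃ w₁ T hT).injective

variable (hfix : ∀ w : InfinitePlace E, c • w = w)

omit [NumberField F] [NumberField E] in
include hfix in
/-- **`archProjU21` is surjective** (when `c ≠ 1` fixes every infinite place). [folklore] -/
theorem archProjU21_surjective : Function.Surjective (archProjU21 F E c J₃ w₁ T hT hc (hfix w₁.1)) :=
  (archLocalEquivU21 E J₃ w₁ T hT).surjective.comp (archAt_surjective F E c 3 J₃ hc hfix w₁)

omit [NumberField F] [NumberField E] in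
include hfix in
/-- **`archProjU21` is an open map** (when `c ≠ 1` fixes every infinite place). [folklore] -/
theorem isOpenMap_archProjU21 : IsOpenMap (archProjU21 F E c J₃ w₁ T hT hc (hfix w₁.1)) :=
  (archLocalEquivU21 E J₃ w₁ T hT).toHomeomorph.isOpenMap.comp (isOpenMap_archAt F E c 3 J₃ hc hfix w₁)

omit [NumberField F] [NumberField E] in
include hfix in
/-- **The kernel of `archProjU21` is compact when `σ_w(J)` is definite at every `w ≠ w₁`**
(`isCompact_ker_archAt`). [cite: PlatonovRapinchuk1994, §3.2 Thm 3.1] -/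
theorem isCompact_ker_archProjU21
    (hdef : ∀ w : {w : InfinitePlace E // IsComplex w}, w ≠ w₁ →
      (J₃.map w.1.embedding).PosDef ∨ (-J₃.map w.1.embedding).PosDef) :
    IsCompact ((archProjU21 F E c J₃ w₁ T hT hc (hfix w₁.1)).ker : Set (arch F E c 3 J₃)) := by
  rw [ker_archProjU21]
  exact isCompact_ker_archAt F E c 3 J₃ hc hfix w₁ hdef

end U21

/-! ## § 3. The CM case -/

section CM

open Literature.Geometry.ComplexHyperbolic Literature.Geometry.ComplexHyperbolic.BallModel

variable (L : Type) [Field L] [NumberField L] [IsCMField L] (H : Matrix (Fin 3) (Fin 3) L)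
  (w₁ : {w : InfinitePlace L // IsComplex w}) (T : GL (Fin 3) ℂ)
  (hT : formCongr (starRingEnd ℂ) T (H.map w₁.1.embedding) = BallModel.J)

/-- **CM case: the archimedean projection `U(H)(L ⊗ ℝ) →* U(2,1)` at the distinguished place `w₁`**
(`F = L⁺`, `c` = complex conjugation), for a frame `T` with `Tᴴ σ_{w₁}(H) T = diag(1,1,-1)`. [cite: BorelJacquet1979, §4.1] -/
def archProjU21CM : arch (↥(maximalRealSubfield L)) L (IsCMField.complexConj L) 3 H →* U21 :=
  archProjU21 _ L (IsCMField.complexConj L) H w₁ T hT (IsCMField.complexConj_ne_one L)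
    (complexConj_smul_infinitePlace L w₁.1)

/-- `archProjU21CM g = T⁻¹ g_{w₁} T` on underlying invertible matrices. [folklore] -/
@[simp] theorem coe_archProjU21CM_apply (g : arch (↥(maximalRealSubfield L)) L (IsCMField.complexConj L) 3 H) :
    ((archProjU21CM L H w₁ T hT g : U21) : GL (Fin 3) ℂ) =
      T⁻¹ * (archAt (↥(maximalRealSubfield L)) L (IsCMField.complexConj L) 3 H w₁
        (complexConj_smul_infinitePlace L w₁.1) (IsCMField.complexConj_ne_one L) g : archLocal L 3 H w₁) * T :=
  rfl

/-- CM case, rational points: `archProjU21CM (γ ⊗ 1) = T⁻¹ σ_{w₁}(γ) T` for `γ ∈ U(H)(L⁺)`. [folklore] -/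
theorem coe_archProjU21CM_rationalToArch
    (γ : rational (↥(maximalRealSubfield L)) L (IsCMField.complexConj L) 3 H) :
    ((archProjU21CM L H w₁ T hT (rationalToArch (↥(maximalRealSubfield L)) L (IsCMField.complexConj L) 3 H γ) :
        U21) : GL (Fin 3) ℂ) =
      T⁻¹ * Matrix.GeneralLinearGroup.map w₁.1.embedding (γ : GL (Fin 3) L) * T :=
  coe_archProjU21_rationalToArch _ L _ H w₁ T hT _ _ γ

/-- `archProjU21CM` is continuous. [folklore] -/
theorem continuous_archProjU21CM : Continuous (archProjU21CM L H w₁ T hT) :=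
  continuous_archProjU21 _ L _ H w₁ T hT _ _

/-- `archProjU21CM` is surjective. [folklore] -/
theorem archProjU21CM_surjective : Function.Surjective (archProjU21CM L H w₁ T hT) :=
  archProjU21_surjective _ L _ H w₁ T hT _ (complexConj_smul_infinitePlace L)

/-- `archProjU21CM` is an open map. [folklore] -/
theorem isOpenMap_archProjU21CM : IsOpenMap (archProjU21CM L H w₁ T hT) :=
  isOpenMap_archProjU21 _ L _ H w₁ T hT _ (complexConj_smul_infinitePlace L)

/-- The kernel of `archProjU21CM` is `ker (archAt w₁)`. [folklore] -/
theorem ker_archProjU21CM :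
    (archProjU21CM L H w₁ T hT).ker =
      (archAt (↥(maximalRealSubfield L)) L (IsCMField.complexConj L) 3 H w₁
        (complexConj_smul_infinitePlace L w₁.1) (IsCMField.complexConj_ne_one L)).ker :=
  ker_archProjU21 _ L _ H w₁ T hT _ _

/-- **CM case: the kernel of the archimedean projection is compact when `σ_w(H)` is definite at every `w ≠ w₁`**
— signature `(2,1)` at `w₁`, `(3,0)` elsewhere: `U(H)(L ⊗ ℝ) = U(2,1) × compact`. [cite: PlatonovRapinchuk1994, §3.2 Thm 3.1] -/
theorem isCompact_ker_archProjU21CM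
    (hdef : ∀ w : {w : InfinitePlace L // IsComplex w}, w ≠ w₁ →
      (H.map w.1.embedding).PosDef ∨ (-H.map w.1.embedding).PosDef) :
    IsCompact ((archProjU21CM L H w₁ T hT).ker :
      Set (arch (↥(maximalRealSubfield L)) L (IsCMField.complexConj L) 3 H)) :=
  isCompact_ker_archProjU21 _ L _ H w₁ T hT _ (complexConj_smul_infinitePlace L) hdef

end CM

end UnitaryGroup

end Literature.NumberTheory.Automorphic

end
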